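import Summits.BirchSwinnertonDyer.Rank1Residual.AdditivePotMult.QuadraticBaseChangeDescentUnramifiedFactOddPrime
import Summits.BirchSwinnertonDyer.Rank1Residual.AdditivePotMult.ClassTheoremsNoMilne
import HarnessLib

/-!
# X4(M)⁰ / X3♯(M)⁰ class theorems of the base-change-and-descend route WITHOUT the Milne hypothesis,
# with additive places prime to `d_K` allowed at EVERY ODD `p` (`p = 3` included), CONDITIONAL on A233
# (row T-MIL-3, FILE H-3 — the S₂/S₃ twins of FILE E-4; seat n1011-p01 GEN 8)

HONEST FRAMING (cell `b2b-bsdres`, run/shared/lean/b2b/bsd-rank1-residual/, verbatim in every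
file): the goal of the cell is to DELETE the COMBINATION-SHAPED residual classes of the
Birch–Swinnerton-Dyer formula for ALL analytic-rank `≤ 1` elliptic curves over `ℚ` — "full BSD
formula for every rank `≤ 1` curve in class `C`" assembled STRICTLY from published theorems — so
that the rank-`≤ 1` remainder becomes exactly the CONSTRUCTION-SHAPED classes, which are TYPED
(missing-input `Prop`s), NOT attempted. This is not "finishing BSD". Sub-classes X3♯(M) / X4(M)
(additive, potentially multiplicative prime; base-change-and-descend): a RESEARCH ROUTE; they stay
CONSTRUCTION-SHAPED; nothing is booked by this file; no mark / label moved. THEOREMS ONLY: no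
definition, no named fact, no `sorry`.

## What

FILE E-4 (`ClassTheoremsNoMilne`) states the X4(M)⁰ / X3♯(M)⁰ class theorems WITHOUT Milne's A65 on
S₁: `W` good ∨ multiplicative ∨ (`ℓ ∣ d_K` ∧ `Wd` multiplicative) at every place — no additive place
besides the potentially multiplicative ramified ones. FILE H-2
(`bsdp_of_pPartOver_of_bsdp_twist_quadratic_of_unramifiedFact_odd`) descends at every odd `p` with
ADDITIVE places prime to `d_K` allowed (the `p = 3` proviso: `ℓ ≠ 3`, and at `ℓ = 2` either `2` split
in `K` or Kodaira type `≠ IV, IV*`), CONDITIONAL on A233 (`hA`). This file is E-4 on that larger population: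

* `bsdp_of_classX4M_of_rankZero_twist_noMilne_of_unramifiedFact` — **X4(M)⁰ (analytic rank `≤ 1`,
  twist of analytic rank `0` multiplicative at `p` with (ram)), `K` quadratic of either signature
  with `d_K` odd squarefree, `W` good ∨ multiplicative ∨ (`ℓ ∣ d_K` ∧ `Wd` multiplicative) ∨
  (additive, `ℓ ∤ d_K`, `p = 3` proviso) at every place: `BSD(E,p) ⇐ MissingPPartOverAt W' p`**, the
  other inputs being Skinner 2016 Thm. C (`hSk`), `hGZK`, `hmod` and A233 (`hA`) — NOT A65;
* `bsdp_of_classX3M_of_rankZero_twist_noMilne_of_unramifiedFact` — **X3♯(M)⁰ likewise: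
  `BSD(E,p) ⇐ MissingPPartOverAt W' p ∧ MissingLowerBoundAt Wd p`** (Wuthrich 2014 Prop. 21 `hW`,
  `hGZK`, `hmod`, `hA`).

HONEST LIMITS: CONDITIONAL on A233 (`hA`, a named fact; row T-A233 of n1011-p16 discharges it);
`d_K` odd squarefree; twist of analytic rank `0`; at `p = 3` the proviso excludes additive places
over `2` of type `IV`/`IV*` (with `K = ℚ(√−3)`, `2` is inert: the `ℓ = 2` FLIP is the located gap)
and additive unramified `3`; nothing asserts that such `K` exists for a given pair; X3♯(M)/X4(M)
stay CONSTRUCTION-SHAPED — `MissingPPartOverAt` (and the X2 lower bound) untouched; TOOL/END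
theorems; closes no class; moves no mark; `ClassTheorems.lean` / `ClassTheoremsNoMilne.lean`
untouched (E-4 stays as the S₁ twin free of `hA`).

References: J. S. Milne, Invent. Math. 17 (1972) [Milne1972ArithmeticAV]; C. Skinner, Pacific J.
Math. 283 (2016) Thm. C [Skinner2016PacificMC]; C. Wuthrich, Doc. Math. 19 (2014) Prop. 21
[Wuthrich2014]; J. H. Silverman, *AEC* 2nd ed. Prop. VII.5.4 (a) [SilvermanAEC2009], *ATAEC*
IV.9.4 and Table 4.1 [SilvermanATAEC1994]; R. L. Miller, LMS J. Comput. Math. 14 (2011) Def. 1.1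
[Miller2011LMS].
-/

noncomputable section

open scoped Classical NumberField

open WeierstrassCurve NumberField IsDedekindDomain Rat.HeightOneSpectrum
  Literature.NumberTheory.EllipticCurves Literature.NumberTheory.EllipticCurves.Rank1Residual
  Literature.NumberTheory.EllipticCurves.Rank1Residual.Typed
  Literature.NumberTheory.EllipticCurves.Wuthrich2014
  Literature.NumberTheory.DiophantineGeometry

namespace Summit.BirchSwinnertonDyer.Rank1Residual.AdditivePotMult

section NoMilneUnramifiedFact

variable (W : WeierstrassCurve ℚ) [W.IsElliptic] [W.IsGloballyMinimal] (p : ℕ) [Fact p.Prime]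
  (K : Type) [Field K] [NumberField K]
  (Wd : WeierstrassCurve ℚ) [Wd.IsElliptic] [Wd.IsGloballyMinimal]
  (W' : WeierstrassCurve K) [W'.IsElliptic] [W'.IsGloballyMinimal]

/-- **X4(M)⁰ WITHOUT MILNE, additive places prime to `d_K` allowed, every odd `p` (`p = 3`
included), CONDITIONAL on A233.** For `(E,p) ∈ X4(M)` (odd additive `p`, `E[p]` irreducible,
`ord_p j < 0`) of analytic rank `≤ 1`, a quadratic field `K` (either signature) with `d_K` odd
squarefree whose twist `Wd = C_d • W^{(d_K)}` is MULTIPLICATIVE at `p`, of analytic rank `0`, with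
(ram), `W` good ∨ multiplicative ∨ (`ℓ ∣ d_K` ∧ `Wd` multiplicative) ∨ (additive ∧ `ℓ ∤ d_K` ∧ the
`p = 3` proviso `p = 3 → ℓ ≠ 3 ∧ (ℓ = 2 → d_K % 8 = 1 ∨ W.kodairaSymbolAt v ≠ IV, IV*)`) at every place, a
globally minimal `K`-model `W' = C' • W_K`, and the named fact A233 at every `(v, w)` as `hA`:
**`BSD(E, p)` follows from the typed over-`K` input `MissingPPartOverAt W' p` ALONE**, the other
inputs being Skinner 2016 Thm. C (`hSk`: the twist is COVERED, `bsdp_twist_of_rankZero_ram`),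
`hGZK`, `hmod`, `hA` — NOT Milne's A65. Twin of E-4's `bsdp_of_classX4M_of_rankZero_twist_noMilne`
on S₂/S₃ (H-2's END `bsdp_of_pPartOver_of_bsdp_twist_quadratic_of_unramifiedFact_odd`). Nothing
asserts that such `K` exists for a given pair. [cite: Skinner2016PacificMC, Thm. C (§1), footnote 1, §2.5]
[cite: Milne1972ArithmeticAV, §1 Thm. 1 and §2 (through DokchitserDokchitserAnnals2010, §2.1, proof of Thm. 8)]
[cite: SilvermanAEC2009, Prop. VII.5.4 (a)] -/
theorem bsdp_of_classX4M_of_rankZero_twist_noMilne_of_unramifiedFact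
    (hGZK : rank_eq_analyticRank_of_analyticRank_le_one) (hmod : hasEntireLFunction_rat)
    (hSk : Skinner2016.thmC_padicValRat_bsd_rank_zero)
    (hX : ClassX4M W p) (hr : W.analyticRank ≤ 1) (h2 : Module.finrank ℚ K = 2)
    (hdodd : Odd (NumberField.discr K)) (hdsq : Squarefree (NumberField.discr K))
    {Cd : VariableChange ℚ} (hWd : Cd • W.quadraticTwist (NumberField.discr K : ℚ) = Wd)
    (hmult : Mult Wd p) (hram : Ram Wd p) (hr0 : Wd.analyticRank = 0)
    {C' : VariableChange K} (hW' : C' • W.baseChange K = W')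
    (hA : ∀ (v : HeightOneSpectrum (𝓞 ℚ)) (w : HeightOneSpectrum (𝓞 K)),
      kodairaSymbolAt_baseChange_of_ramificationIdx_eq_one K v w W)
    (hS : ∀ v : HeightOneSpectrum (𝓞 ℚ), W.HasGoodReductionAt v ∨ W.HasMultiplicativeReductionAt v ∨
      (((primesEquiv v : ℕ) : ℤ) ∣ NumberField.discr K ∧ Wd.HasMultiplicativeReductionAt v) ∨
      (W.HasAdditiveReductionAt v ∧ ¬ ((primesEquiv v : ℕ) : ℤ) ∣ NumberField.discr K ∧
        (p = 3 → (primesEquiv v : ℕ) ≠ 3 ∧ ((primesEquiv v : ℕ) = 2 → NumberField.discr K % 8 = 1 ∨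
          (W.kodairaSymbolAt v ≠ .IV ∧ W.kodairaSymbolAt v ≠ .IVstar)))))
    (hK : MissingPPartOverAt W' p) : BSDp W p := by
  have hD : (NumberField.discr K : ℚ) ≠ 0 := by exact_mod_cast NumberField.discr_ne_zero K
  obtain ⟨hp2, -, hirrd⟩ := mult_irr_twist_of_classX4M hX hD ⟨Cd, hWd⟩ hmult
  have hd : BSDp Wd p := bsdp_twist_of_rankZero_ram p Wd hSk hGZK hmod hp2 hmult hirrd hram hr0
  exact bsdp_of_pPartOver_of_bsdp_twist_quadratic_of_unramifiedFact_odd W p K Wd W' hGZK hmod h2 hdodd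
    hdsq hWd hW' (by omega) hA hp2 hS hK hd

/-- **X3♯(M)⁰ WITHOUT MILNE, additive places prime to `d_K` allowed, every odd `p` (`p = 3`
included), CONDITIONAL on A233: `BSD(E,p) ⇐ MissingPPartOverAt(E_K,p) ∧ MissingLowerBoundAt(E^{(D)},p)`.**
For `(E,p) ∈ X3♯(M)` (odd additive Eisenstein `p`, `ord_p j < 0`) of analytic rank `≤ 1`, a
quadratic field `K` (either signature) with `d_K` odd squarefree whose twist `Wd = C_d • W^{(d_K)}`
is MULTIPLICATIVE at `p` and of analytic rank `0`, `W` good ∨ multiplicative ∨ (`ℓ ∣ d_K` ∧ `Wd`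
multiplicative) ∨ (additive ∧ `ℓ ∤ d_K` ∧ the `p = 3` proviso) at every place, `W' = C' • W_K`
globally minimal, and A233 at every `(v, w)` as `hA`: `BSD(E,p)` follows from `MissingPPartOverAt W' p`
AND the LOWER half `MissingLowerBoundAt Wd p` of the X2 input of the twist (an X2 pair,
`classX2_twist_of_classX3M`; upper half = Wuthrich 2014 Prop. 21, `hW`), with `hGZK`, `hmod`, `hA`
— NOT Milne's A65. Twin of E-4's `bsdp_of_classX3M_of_rankZero_twist_noMilne` on S₂/S₃.
[cite: Wuthrich2014, Prop. 21]
[cite: Milne1972ArithmeticAV, §1 Thm. 1 and §2 (through DokchitserDokchitserAnnals2010, §2.1, proof of Thm. 8)]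
[cite: SilvermanAEC2009, Prop. VII.5.4 (a)] -/
theorem bsdp_of_classX3M_of_rankZero_twist_noMilne_of_unramifiedFact
    (hGZK : rank_eq_analyticRank_of_analyticRank_le_one) (hmod : hasEntireLFunction_rat)
    (hW : sha_dvd_analyticSha)
    (hX : ClassX3M W p) (hr : W.analyticRank ≤ 1) (h2 : Module.finrank ℚ K = 2)
    (hdodd : Odd (NumberField.discr K)) (hdsq : Squarefree (NumberField.discr K))
    {Cd : VariableChange ℚ} (hWd : Cd • W.quadraticTwist (NumberField.discr K : ℚ) = Wd)
    (hmult : Mult Wd p) (hr0 : Wd.analyticRank = 0)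
    {C' : VariableChange K} (hW' : C' • W.baseChange K = W')
    (hA : ∀ (v : HeightOneSpectrum (𝓞 ℚ)) (w : HeightOneSpectrum (𝓞 K)),
      kodairaSymbolAt_baseChange_of_ramificationIdx_eq_one K v w W)
    (hS : ∀ v : HeightOneSpectrum (𝓞 ℚ), W.HasGoodReductionAt v ∨ W.HasMultiplicativeReductionAt v ∨
      (((primesEquiv v : ℕ) : ℤ) ∣ NumberField.discr K ∧ Wd.HasMultiplicativeReductionAt v) ∨
      (W.HasAdditiveReductionAt v ∧ ¬ ((primesEquiv v : ℕ) : ℤ) ∣ NumberField.discr K ∧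
        (p = 3 → (primesEquiv v : ℕ) ≠ 3 ∧ ((primesEquiv v : ℕ) = 2 → NumberField.discr K % 8 = 1 ∨
          (W.kodairaSymbolAt v ≠ .IV ∧ W.kodairaSymbolAt v ≠ .IVstar)))))
    (hK : MissingPPartOverAt W' p) (hlow : MissingLowerBoundAt Wd p) : BSDp W p := by
  have hD : (NumberField.discr K : ℚ) ≠ 0 := by exact_mod_cast NumberField.discr_ne_zero K
  have hX2d : ClassX2 Wd p := classX2_twist_of_classX3M hX hD ⟨Cd, hWd⟩ hmult
  have hd : BSDp Wd p := X2.bsdp_of_missingInputAt hW hGZK hmod Wd p (by rw [hr0]; exact zero_le_one)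
    hX2d ⟨fun _ => hlow, fun h1 => absurd (hr0.symm.trans h1) (by decide)⟩
  exact bsdp_of_pPartOver_of_bsdp_twist_quadratic_of_unramifiedFact_odd W p K Wd W' hGZK hmod h2 hdodd
    hdsq hWd hW' (by omega) hA hX.p_ne_two hS hK hd

end NoMilneUnramifiedFact

end Summit.BirchSwinnertonDyer.Rank1Residual.AdditivePotMult

end
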